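import Summits.Parity.GeneralizedHardyLittlewood.Theorems.LiouvilleShiftedTablesTypeI2DilatedPeel4

/-!
# The peel, part 5/6: the crux sum at one height `x`

Route `LiouvilleShiftedTables` (Parity / GeneralizedHardyLittlewood), crux `TypeI2Dilated` (stmt-Parity-14272),
line `peel-to-drappeau`, registered stub `stub_peel : PeelStep` (`PeelStep := DrappeauTypeII → DilatedTypeIICore`,
vocabulary in `…Theorems.LiouvilleShiftedTablesDefs`).  THE PEEL moves the two rough moduli
(`r` and the dilation `q`, both `≤ x^ρ`) and their classes onto the coefficients, so that Drappeau's
hypothesis-free Theorem 5.1 (S. Drappeau, Proc. LMS 114 (2017), arXiv:1504.05549, §5 — the Literature named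
fact `Drappeau2017_theorem51`, taken as the hypothesis `DrappeauTypeII`) applies on the smooth modulus `s` alone:
CRT class `e mod lcm(q, r)` → `g ∣ mh` × a unit class expanded in characters `ξ mod L'` (absorbed into `α`, `β`),
the `(qr)^∞`-part `h` of the `β`-variable split off (`h ≤ x^{6ρ₀}`: Theorem 5.1 at `x' = MN/h` with
`a₁ = c·qr`, `a₂ = h·qr`; `h > x^{6ρ₀}`: the trivial bound (5.2) and `∑_{h ∣ (qr)^∞} h^{-1/2} ≤ τ(qr)²`),
`ρ₀ = min(δ_{5.1}(η/2), η)/100`.  Everything here is PROVED; the only non-Mathlib inputs are the Literature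
lemmas `Literature.NumberTheory.Sieve.DrappeauDispersionLemmas` (all proved) and the divisor bound
(`DivisorBound`, `DivisorPowerSums`).

The chain (each file imports the previous one):
* part 1: the peeled objects and THE PEEL identity (`…TypeI2DilatedPeel1`)
* part 2: matching Theorem 5.1; bounds for the peeled coefficients and blocks (`…TypeI2DilatedPeel2`)
* part 3: CRT, from blocks to the pair, and the main blocks via Theorem 5.1 (`…TypeI2DilatedPeel3`)
* part 4: the per-pair bound (`…TypeI2DilatedPeel4`)
* part 5: the crux sum at one height `x` (`…TypeI2DilatedPeel5`)
* part 6: constants, thresholds and `stub_peel` (`…TypeI2DilatedPeel6`)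

[this line; cite: Drappeau2017, Thm 5.1, §5 (5.1)–(5.2)]
-/

noncomputable section

namespace Summit.Parity.GeneralizedHardyLittlewood.Cruxes.TypeI2Dilated.PeelToDrappeau

open Finset Real
open scoped ArithmeticFunction.sigma Classical
open Literature.NumberTheory.Sieve Literature.NumberTheory.Sieve.Drappeau2017

/-! ### The crux sum at one `x` (sum over the pairs `(q, r)`) -/

/-- `∑_{1 ≤ s ≤ n} 1/s ≤ 1 + log n` for `n ≥ 1` (Mathlib's `harmonic_le_one_add_log`). [folklore] -/
theorem sum_Icc_inv_le_log (n : ℕ) :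
    ∑ s ∈ Icc 1 n, (1 : ℝ) / s ≤ 1 + Real.log n := by
  have h := harmonic_le_one_add_log n
  rw [harmonic_eq_sum_Icc, Rat.cast_sum] at h
  simpa [one_div] using h

/-- `∑_{1 ≤ s ≤ ⌊Y⌋} τ(s)²/s ≤ D² (1 + log x)` when `τ ≤ D` on `[1, X]`, `Y ≤ x ≤ X`, `x ≥ 1`. [folklore] -/
theorem sum_sigma_sq_div_le {D X x Y : ℝ} (hx : 1 ≤ x) (hYx : Y ≤ x) (hxX : x ≤ X)
    (hXτ : ∀ n : ℕ, n ≠ 0 → (n : ℝ) ≤ X → (σ 0 n : ℝ) ≤ D) :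
    ∑ s ∈ Icc 1 ⌊Y⌋₊, (σ 0 s : ℝ) ^ 2 / s ≤ D ^ 2 * (1 + Real.log x) := by
  have hlog : 0 ≤ Real.log x := Real.log_nonneg hx
  rcases Nat.eq_zero_or_pos ⌊Y⌋₊ with h0 | hpos
  · rw [h0]
    simp only [show Icc 1 0 = (∅ : Finset ℕ) by rfl, Finset.sum_empty]
    positivity
  have hY1 : (1 : ℝ) ≤ ⌊Y⌋₊ := by exact_mod_cast hpos
  have hYpos : 0 < Y := by
    by_contra hneg
    push Not at hneg
    have := Nat.floor_eq_zero.2 (by linarith : Y < 1)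
    omega
  have hfl : (⌊Y⌋₊ : ℝ) ≤ x := (Nat.floor_le hYpos.le).trans hYx
  calc ∑ s ∈ Icc 1 ⌊Y⌋₊, (σ 0 s : ℝ) ^ 2 / s ≤ ∑ s ∈ Icc 1 ⌊Y⌋₊, D ^ 2 * ((1 : ℝ) / s) := by
        refine Finset.sum_le_sum fun s hs => ?_
        obtain ⟨hs1, hs2⟩ := Finset.mem_Icc.1 hs
        have hsX : (s : ℝ) ≤ X := by
          have : (s : ℝ) ≤ ⌊Y⌋₊ := by exact_mod_cast hs2
          linarith
        have hσ : (σ 0 s : ℝ) ≤ D := hXτ s (by omega) hsX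
        rw [mul_one_div]
        refine div_le_div_of_nonneg_right ?_ (Nat.cast_nonneg _)
        exact pow_le_pow_left₀ (Nat.cast_nonneg _) hσ 2
    _ = D ^ 2 * ∑ s ∈ Icc 1 ⌊Y⌋₊, (1 : ℝ) / s := by rw [Finset.mul_sum]
    _ ≤ D ^ 2 * (1 + Real.log ⌊Y⌋₊) :=
        mul_le_mul_of_nonneg_left (sum_Icc_inv_le_log _) (by positivity)
    _ ≤ D ^ 2 * (1 + Real.log x) := by
        gcongr

/-- `C (log y)^{c₀} ≤ |C| (log Y)^{|c₀|}` for `e ≤ y ≤ Y`. [folklore] -/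
theorem mul_log_rpow_le {C c₀ y Y : ℝ} (hy : Real.exp 1 ≤ y) (hyY : y ≤ Y) :
    C * Real.log y ^ c₀ ≤ |C| * Real.log Y ^ |c₀| := by
  have hy0 : 0 < y := (Real.exp_pos 1).trans_le hy
  have hlog1 : 1 ≤ Real.log y := by rwa [Real.le_log_iff_exp_le hy0]
  have hlogY : Real.log y ≤ Real.log Y := Real.log_le_log hy0 hyY
  have h1 : Real.log y ^ c₀ ≤ Real.log Y ^ |c₀| :=
    (Real.rpow_le_rpow_of_exponent_le hlog1 (le_abs_self c₀)).trans
      (Real.rpow_le_rpow (by linarith) hlogY (abs_nonneg c₀))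
  have h0 : 0 ≤ Real.log y ^ c₀ := Real.rpow_nonneg (by linarith) c₀
  calc C * Real.log y ^ c₀ ≤ |C| * Real.log y ^ c₀ :=
        mul_le_mul_of_nonneg_right (le_abs_self C) h0
    _ ≤ |C| * Real.log Y ^ |c₀| := mul_le_mul_of_nonneg_left h1 (abs_nonneg C)

section WithTheorem51

/-! The section hypothesis `h51`: Drappeau's Theorem 5.1 at fixed `(η₅, δ, K, C₅, c₀, x₅)` — literally the
inner statement of `Literature.NumberTheory.Sieve.Drappeau2017_theorem51` once its quantifiers
`∀ η ∃ δ ∀ A ∃ C c₀ x₀` are instantiated. -/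

variable {η₅ δ K C₅ c₀ x₅ : ℝ}
  (h51 : ∀ x : ℝ, x₅ ≤ x →
    ∀ M N S Rd : ℝ, M * N = x → x ^ η₅ ≤ N → N ≤ S ^ (2 / 3 - η₅) → x ^ (1 / 4 : ℝ) ≤ S →
      S ≤ x ^ (1 / 2 + δ) → 1 ≤ Rd → Rd ≤ x ^ δ →
    ∀ a₁ a₂ : ℤ, a₁ ≠ 0 → a₂ ≠ 0 → (|a₁| : ℝ) ≤ x ^ δ → (|a₂| : ℝ) ≤ x ^ δ →
    ∀ α β : ℕ → ℂ, (∀ m, ‖α m‖ ≤ (σ 0 m : ℝ) ^ K) → (∀ n, ‖β n‖ ≤ (σ 0 n : ℝ) ^ K) →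
      ‖∑ s ∈ (BFI.dyadic S).filter (fun s : ℕ => IsCoprime (s : ℤ) (a₁ * a₂)),
          ∑ m ∈ BFI.dyadic M, ∑ n ∈ (BFI.dyadic N).filter (fun n : ℕ => IsCoprime (n : ℤ) a₂),
            α m * β n *
              uR Rd s (((m * n : ℕ) : ZMod s) * ((a₁ : ZMod s))⁻¹ * ((a₂ : ZMod s)))‖ ≤
        C₅ * x * Real.log x ^ c₀ / Rd)
include h51

-- one long bookkeeping proof (≈ 40 hypotheses in context); the default budget is exceeded by ~30%.
set_option maxHeartbeats 400000 in
/-- **THE PEEL at one `x`**: the crux sum of `DilatedTypeIICore` at height `x`, bounded pair by pair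
(`#pairs ≤ x^{2ρ}`, `τ(qr)² ≤ C₂² x^ρ`, per pair `norm_TL_le`), given Theorem 5.1 as the section
hypothesis `h51` and the numerical side conditions `d1`–`d10` at `x` (all of the form "a fixed power of `x`
dominates", discharged for `x ≥ x₀` in `stub_peel`). [this line] -/
theorem peel_at (hK : 0 ≤ K)
    (hη₅ : 0 ≤ η₅) (hη₅' : η₅ ≤ 2 / 3) (hδ : 0 ≤ δ)
    {c : ℤ} (hc : c ≠ 0) {x ρ ρ₀ η : ℝ} (hx : 1 ≤ x) (hρ : 0 < ρ) (hρρ₀ : ρ ≤ ρ₀)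
    (hρ₀7 : 7 * ρ₀ < 1) (hη0 : 0 ≤ η)
    {M N : ℝ} (hN1 : x ^ η ≤ N) (hN2 : N ≤ x ^ (1 / 3 - η)) (hMN1 : x ^ (1 - ρ₀) ≤ M * N)
    (hMN2 : M * N ≤ 256 * x)
    {α β : ℕ → ℂ} (hα : ∀ m, ‖α m‖ ≤ (σ 0 m : ℝ) ^ K) (hβ : ∀ n, ‖β n‖ ≤ (σ 0 n : ℝ) ^ K)
    (u v : ℕ → ℤ) {R Slo Rd : ℝ} (hR : R ≤ x ^ ρ) (hSlo : x ^ (1 / 2 - ρ₀) ≤ Slo)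
    (hSloR : 2 * Slo * R ≤ x ^ (1 / 2 + ρ)) (hRd : 1 ≤ Rd) (hRdx : Rd ≤ x ^ ρ₀)
    {C₁ C₂ Cτ ε₃ : ℝ} (hC₁ : 0 ≤ C₁)
    (hC₁h : ∀ h : ℕ, h ≠ 0 → (σ 0 h : ℝ) ^ K ≤ C₁ * (h : ℝ) ^ (1 / 2 : ℝ))
    (hC₂h : ∀ n : ℕ, n ≠ 0 → (σ 0 n : ℝ) ≤ C₂ * (n : ℝ) ^ (1 / 4 : ℝ))
    (hCτ : 1 ≤ Cτ) (hε₃ : 0 < ε₃) (hCτh : ∀ n : ℕ, n ≠ 0 → (σ 0 n : ℝ) ≤ Cτ * (n : ℝ) ^ ε₃)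
    (d1 : x₅ ≤ x ^ (1 - 7 * ρ₀)) (d2 : (256 * x) ^ η₅ ≤ x ^ η / x ^ (6 * ρ₀))
    (d3 : x ^ (1 / 3 - η) ≤ (x ^ (1 / 2 - ρ₀)) ^ (2 / 3 - η₅))
    (d4 : (256 * x) ^ (1 / 4 : ℝ) ≤ x ^ (1 / 2 - ρ₀))
    (d5 : x ^ (1 / 2 + ρ) ≤ (x ^ (1 - 7 * ρ₀)) ^ (1 / 2 + δ))
    (d6 : x ^ ρ₀ ≤ (x ^ (1 - 7 * ρ₀)) ^ δ) (d7 : |(c : ℝ)| * x ^ (2 * ρ) ≤ (x ^ (1 - 7 * ρ₀)) ^ δ)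
    (d8 : x ^ (6 * ρ₀) * x ^ (2 * ρ) ≤ (x ^ (1 - 7 * ρ₀)) ^ δ) (d9 : Real.exp 1 ≤ x ^ (1 - 7 * ρ₀))
    (d10 : |(c : ℝ)| < x ^ (1 - ρ₀)) :
    (∑ q ∈ Icc 1 ⌊x ^ ρ⌋₊, ∑ r ∈ Icc 1 ⌊R⌋₊, ‖T0 c Rd q r Slo M N α β (u r) (v q)‖) ≤
      x ^ ρ * x ^ ρ *
        (C₂ ^ 2 * x ^ ρ * (256 * x) *
          (C₁ * (|C₅| * Real.log (256 * x) ^ |c₀|) / Rd +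
            4 * ((Cτ * (2048 * x) ^ ε₃) ^ K) ^ 2 *
              ((Cτ * (2048 * x) ^ ε₃) + Rd * ((Cτ * (2048 * x) ^ ε₃) ^ 2 * (1 + Real.log x))) *
              (x ^ (6 * ρ₀)) ^ (-(1 / 2 : ℝ)))) := by
  -- basic positivity
  have hx0 : 0 < x := by linarith
  have hxη : 0 < x ^ η := Real.rpow_pos_of_pos hx0 η
  have hN0 : 0 < N := hxη.trans_le hN1
  have hMN0 : 0 < M * N := (Real.rpow_pos_of_pos hx0 _).trans_le hMN1
  have hM0 : 0 < M := by
    by_contra hneg; push Not at hneg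
    have : M * N ≤ 0 := mul_nonpos_iff.2 (Or.inr ⟨hneg, hN0.le⟩)
    linarith
  have hSlo0 : 0 < Slo := (Real.rpow_pos_of_pos hx0 _).trans_le hSlo
  have hRd0 : 0 < Rd := by linarith
  have hx1 : (1 : ℝ) ≤ x ^ (1 : ℝ) := by rw [Real.rpow_one]; exact hx
  -- names
  set D : ℝ := Cτ * (2048 * x) ^ ε₃ with hDdef
  set H : ℝ := x ^ (6 * ρ₀) with hHdef
  set Λ₁ : ℝ := |C₅| * Real.log (256 * x) ^ |c₀| with hΛ₁def
  set Λ₂ : ℝ := D ^ 2 * (1 + Real.log x) with hΛ₂def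
  set X : ℝ := 2048 * x with hXdef
  set Y₁ : ℝ := x ^ (1 - 7 * ρ₀) with hY₁def
  have hH1 : 1 ≤ H := Real.one_le_rpow hx (by linarith [hρ.le.trans hρρ₀])
  have hH0 : 0 < H := by linarith
  have hD1 : 1 ≤ D := by
    have : (1 : ℝ) ≤ (2048 * x) ^ ε₃ := Real.one_le_rpow (by linarith) hε₃.le
    exact one_le_mul_of_one_le_of_one_le hCτ this
  have hD0 : 0 ≤ D := by linarith
  have hlog256 : 0 ≤ Real.log (256 * x) := Real.log_nonneg (by linarith)
  have hΛ₁0 : 0 ≤ Λ₁ := mul_nonneg (abs_nonneg _) (Real.rpow_nonneg hlog256 _)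
  have hlogx : 0 ≤ Real.log x := Real.log_nonneg hx
  have hΛ₂0 : 0 ≤ Λ₂ := by positivity
  have hY₁0 : 0 < Y₁ := Real.rpow_pos_of_pos hx0 _
  -- divisor bounds on `[1, X]`
  have hXτ : ∀ n : ℕ, n ≠ 0 → (n : ℝ) ≤ X → (σ 0 n : ℝ) ≤ D := by
    intro n hn hnX
    refine (hCτh n hn).trans ?_
    rw [hDdef]
    exact mul_le_mul_of_nonneg_left (Real.rpow_le_rpow (Nat.cast_nonneg _) hnX hε₃.le)
      (by linarith)
  have hXK : ∀ n : ℕ, n ≠ 0 → (n : ℝ) ≤ X → (σ 0 n : ℝ) ^ K ≤ D ^ K := fun n hn hnX =>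
    Real.rpow_le_rpow (Nat.cast_nonneg _) (hXτ n hn hnX) hK
  -- sizes
  have hcMN : (|c| : ℝ) < M * N := d10.trans_le hMN1
  have hxpow_le_x : ∀ t : ℝ, t ≤ 1 → x ^ t ≤ x := fun t ht => by
    calc x ^ t ≤ x ^ (1 : ℝ) := Real.rpow_le_rpow_of_exponent_le hx ht
      _ = x := Real.rpow_one x
  have hM_le : M ≤ 256 * x := by
    have hN1' : 1 ≤ N := le_trans (Real.one_le_rpow hx hη0) hN1
    calc M = M * 1 := (mul_one M).symm
      _ ≤ M * N := mul_le_mul_of_nonneg_left hN1' hM0.le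
      _ ≤ 256 * x := hMN2
  have hXM : 2 * M ≤ X := by rw [hXdef]; linarith
  have hN_le : N ≤ x := hN2.trans (hxpow_le_x _ (by linarith))
  have hXN : 2 * N ≤ X := by rw [hXdef]; linarith
  have hc_le : |(c : ℝ)| ≤ x := d10.le.trans (hxpow_le_x _ (by linarith [hρ.le.trans hρρ₀]))
  have hXk : 4 * (M * N) + |(c : ℝ)| ≤ X := by rw [hXdef]; linarith
  have hxX : x ≤ X := by rw [hXdef]; linarith
  -- the common bracket
  set Br : ℝ := C₁ * Λ₁ / Rd + 4 * (D ^ K) ^ 2 * (D + Rd * Λ₂) * H ^ (-(1 / 2 : ℝ)) with hBrdef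
  have hBr0 : 0 ≤ Br := by positivity
  set pairB : ℝ := C₂ ^ 2 * x ^ ρ * (256 * x) * Br with hpairB
  have hpairB0 : 0 ≤ pairB := by positivity
  -- per pair
  have hpair : ∀ q ∈ Icc 1 ⌊x ^ ρ⌋₊, ∀ r ∈ Icc 1 ⌊R⌋₊,
      ‖T0 c Rd q r Slo M N α β (u r) (v q)‖ ≤ pairB := by
    intro q hq r hr
    obtain ⟨hq1, hq2⟩ := Finset.mem_Icc.1 hq
    obtain ⟨hr1, hr2⟩ := Finset.mem_Icc.1 hr
    have hqpos : 0 < q := hq1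
    have hrpos : 0 < r := hr1
    have hR1 : 1 ≤ R := Nat.floor_pos.1 (hr1.trans hr2)
    have hqx : (q : ℝ) ≤ x ^ ρ :=
      le_trans (by exact_mod_cast hq2) (Nat.floor_le (Real.rpow_nonneg hx0.le _))
    have hrx : (r : ℝ) ≤ x ^ ρ :=
      le_trans (le_trans (by exact_mod_cast hr2) (Nat.floor_le (by linarith))) hR
    have hx2ρ : x ^ ρ * x ^ ρ = x ^ (2 * ρ) := by
      rw [← Real.rpow_add hx0]; ring_nf
    have hP : ((q * r : ℕ) : ℝ) ≤ x ^ (2 * ρ) := by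
      rw [Nat.cast_mul, ← hx2ρ]
      exact mul_le_mul hqx hrx (Nat.cast_nonneg _) (Real.rpow_nonneg hx0.le _)
    have hP0 : (q * r) ≠ 0 := (Nat.mul_pos hqpos hrpos).ne'
    have hSR : Slo ≤ Slo * R := le_mul_of_one_le_right hSlo0.le hR1
    have h2SR : 2 * Slo * R = 2 * (Slo * R) := by ring
    have hSloR1 : Slo ≤ x ^ (1 / 2 + ρ) := by linarith
    have h2Slo : 2 * Slo ≤ x := by
      have h1 : x ^ (1 / 2 + ρ) ≤ x := hxpow_le_x _ (by linarith)
      linarith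
    have hΛ₂s : ∑ s ∈ Icc 1 ⌊2 * Slo⌋₊, (σ 0 s : ℝ) ^ 2 / s ≤ Λ₂ :=
      sum_sigma_sq_div_le hx h2Slo hxX hXτ
    -- `τ(qr)² ≤ C₂² x^ρ`
    have hσP : (σ 0 (q * r) : ℝ) ^ 2 ≤ C₂ ^ 2 * x ^ ρ := by
      have h1 : (σ 0 (q * r) : ℝ) ≤ C₂ * ((q * r : ℕ) : ℝ) ^ (1 / 4 : ℝ) := hC₂h _ hP0
      have h2 : (((q * r : ℕ) : ℝ) ^ (1 / 4 : ℝ)) ^ 2 ≤ x ^ ρ := by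
        rw [← Real.rpow_natCast, ← Real.rpow_mul (Nat.cast_nonneg _)]
        calc ((q * r : ℕ) : ℝ) ^ ((1 / 4 : ℝ) * (2 : ℕ)) ≤ (x ^ (2 * ρ)) ^ ((1 / 4 : ℝ) * (2 : ℕ)) :=
              Real.rpow_le_rpow (Nat.cast_nonneg _) hP (by norm_num)
          _ = x ^ ρ := by rw [← Real.rpow_mul hx0.le]; ring_nf
      calc (σ 0 (q * r) : ℝ) ^ 2 ≤ (C₂ * ((q * r : ℕ) : ℝ) ^ (1 / 4 : ℝ)) ^ 2 :=
            pow_le_pow_left₀ (Nat.cast_nonneg _) h1 2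
        _ = C₂ ^ 2 * ((((q * r : ℕ) : ℝ) ^ (1 / 4 : ℝ)) ^ 2) := by ring
        _ ≤ C₂ ^ 2 * x ^ ρ := mul_le_mul_of_nonneg_left h2 (sq_nonneg _)
    -- the side conditions of Theorem 5.1 on the main blocks
    have hnum : ∀ h ∈ hSet (q * r) ⌊2 * N⌋₊, (h : ℝ) ≤ H →
        x₅ ≤ M * (N / h) ∧ (M * (N / h)) ^ η₅ ≤ N / h ∧ N / h ≤ Slo ^ (2 / 3 - η₅) ∧
        (M * (N / h)) ^ (1 / 4 : ℝ) ≤ Slo ∧ Slo ≤ (M * (N / h)) ^ (1 / 2 + δ) ∧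
        Rd ≤ (M * (N / h)) ^ δ ∧ (|c| : ℝ) * ((q * r : ℕ) : ℝ) ≤ (M * (N / h)) ^ δ ∧
        ((h * (q * r) : ℕ) : ℝ) ≤ (M * (N / h)) ^ δ ∧
        C₅ * Real.log (M * (N / h)) ^ c₀ ≤ Λ₁ := by
      intro h hh hhH
      have hh1 : 1 ≤ h := (mem_hSet.1 hh).1.1
      have hh1' : (1 : ℝ) ≤ h := by exact_mod_cast hh1
      have hhpos : (0 : ℝ) < h := by linarith
      have hy : M * (N / h) = M * N / h := by ring
      have hy0 : 0 ≤ M * (N / h) := by positivity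
      have hY₁y : Y₁ ≤ M * (N / h) := by
        rw [hy]
        calc Y₁ = x ^ (1 - ρ₀) / H := by
              rw [hY₁def, hHdef, ← Real.rpow_sub hx0]; ring_nf
          _ ≤ M * N / H := div_le_div_of_nonneg_right hMN1 hH0.le
          _ ≤ M * N / h := div_le_div_of_nonneg_left hMN0.le hhpos hhH
      have hy256 : M * (N / h) ≤ 256 * x := by
        rw [hy]
        exact (div_le_self hMN0.le hh1').trans hMN2
      refine ⟨d1.trans hY₁y, ?_, ?_, ?_, ?_, ?_, ?_, ?_, ?_⟩
      · calc (M * (N / h)) ^ η₅ ≤ (256 * x) ^ η₅ := Real.rpow_le_rpow hy0 hy256 hη₅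
          _ ≤ x ^ η / x ^ (6 * ρ₀) := d2
          _ ≤ N / H := by rw [hHdef]; exact div_le_div_of_nonneg_right hN1 hH0.le
          _ ≤ N / h := div_le_div_of_nonneg_left hN0.le hhpos hhH
      · calc N / h ≤ N := div_le_self hN0.le hh1'
          _ ≤ x ^ (1 / 3 - η) := hN2
          _ ≤ (x ^ (1 / 2 - ρ₀)) ^ (2 / 3 - η₅) := d3
          _ ≤ Slo ^ (2 / 3 - η₅) :=
              Real.rpow_le_rpow (Real.rpow_nonneg hx0.le _) hSlo (by linarith)
      · calc (M * (N / h)) ^ (1 / 4 : ℝ) ≤ (256 * x) ^ (1 / 4 : ℝ) :=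
              Real.rpow_le_rpow hy0 hy256 (by norm_num)
          _ ≤ x ^ (1 / 2 - ρ₀) := d4
          _ ≤ Slo := hSlo
      · calc Slo ≤ x ^ (1 / 2 + ρ) := hSloR1
          _ ≤ Y₁ ^ (1 / 2 + δ) := d5
          _ ≤ (M * (N / h)) ^ (1 / 2 + δ) := Real.rpow_le_rpow hY₁0.le hY₁y (by linarith)
      · calc Rd ≤ x ^ ρ₀ := hRdx
          _ ≤ Y₁ ^ δ := d6
          _ ≤ (M * (N / h)) ^ δ := Real.rpow_le_rpow hY₁0.le hY₁y hδ
      · calc (|c| : ℝ) * ((q * r : ℕ) : ℝ) ≤ |(c : ℝ)| * x ^ (2 * ρ) := by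
              rw [← Int.cast_abs]
              exact mul_le_mul_of_nonneg_left hP (by positivity)
          _ ≤ Y₁ ^ δ := d7
          _ ≤ (M * (N / h)) ^ δ := Real.rpow_le_rpow hY₁0.le hY₁y hδ
      · calc ((h * (q * r) : ℕ) : ℝ) = (h : ℝ) * ((q * r : ℕ) : ℝ) := by push_cast; ring
          _ ≤ H * x ^ (2 * ρ) := mul_le_mul hhH hP (Nat.cast_nonneg _) hH0.le
          _ ≤ Y₁ ^ δ := by rw [hHdef]; exact d8
          _ ≤ (M * (N / h)) ^ δ := Real.rpow_le_rpow hY₁0.le hY₁y hδ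
      · exact mul_log_rpow_le (d9.trans hY₁y) hy256
    -- the pair
    rcases T0_eq_zero_or c Rd q r Slo M N α β (u r) (v q) with h0 | ⟨e, he⟩
    · rw [h0, norm_zero]; exact hpairB0
    rw [he]
    refine (norm_TL_le h51 hK hc hRd hqpos hrpos hSlo0.le hM0.le hN0.le hcMN hα hβ rfl le_rfl
      hH1 hΛ₁0 hC₁ hD1 (Real.rpow_nonneg hD0 K) hΛ₂0 hnum hC₁h hXτ hXK hXM hXN hXk hΛ₂s).trans ?_
    rw [hpairB]
    calc (σ 0 (q * r) : ℝ) ^ 2 * (M * N) * Br ≤ (C₂ ^ 2 * x ^ ρ) * (256 * x) * Br := by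
          refine mul_le_mul_of_nonneg_right ?_ hBr0
          exact mul_le_mul hσP hMN2 hMN0.le (by positivity)
      _ = _ := by ring
  -- sum over the pairs
  have hcardq : ((Icc 1 ⌊x ^ ρ⌋₊).card : ℝ) ≤ x ^ ρ := by
    rw [Nat.card_Icc, Nat.add_sub_cancel]
    exact Nat.floor_le (Real.rpow_nonneg hx0.le _)
  have hcardr : ((Icc 1 ⌊R⌋₊).card : ℝ) ≤ x ^ ρ := by
    rw [Nat.card_Icc, Nat.add_sub_cancel]
    calc ((⌊R⌋₊ : ℕ) : ℝ) ≤ ⌊x ^ ρ⌋₊ := by exact_mod_cast Nat.floor_le_floor hR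
      _ ≤ x ^ ρ := Nat.floor_le (Real.rpow_nonneg hx0.le _)
  calc (∑ q ∈ Icc 1 ⌊x ^ ρ⌋₊, ∑ r ∈ Icc 1 ⌊R⌋₊, ‖T0 c Rd q r Slo M N α β (u r) (v q)‖)
      ≤ ∑ q ∈ Icc 1 ⌊x ^ ρ⌋₊, ∑ r ∈ Icc 1 ⌊R⌋₊, pairB :=
        Finset.sum_le_sum fun q hq => Finset.sum_le_sum fun r hr => hpair q hq r hr
    _ = ((Icc 1 ⌊x ^ ρ⌋₊).card : ℝ) * (((Icc 1 ⌊R⌋₊).card : ℝ) * pairB) := by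
        rw [Finset.sum_const, Finset.sum_const, nsmul_eq_mul, nsmul_eq_mul]
    _ ≤ x ^ ρ * (x ^ ρ * pairB) :=
        mul_le_mul hcardq (mul_le_mul_of_nonneg_right hcardr hpairB0) (by positivity)
          (Real.rpow_nonneg hx0.le _)
    _ = _ := by rw [hpairB, hBrdef]; ring

end WithTheorem51

/-- Landing anchor of the split peel chain (file 5 of 6): a registered, mathematically vacuous sub-goal
(`ledger workitem stub-add … --name peelChain5_anchor --signature 'True'`) so that this intermediate file passes
the gate's supports check; the registered stub `stub_peel` is proved in file 6. [this line] -/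
theorem peelChain5_anchor : True := trivial

end Summit.Parity.GeneralizedHardyLittlewood.Cruxes.TypeI2Dilated.PeelToDrappeau

end
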